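import Literature.AlgebraicGeometry.HodgeTheory.GAGADimension
import Literature.AlgebraicGeometry.HodgeTheory.GAGADimensionSimplePoint
import Literature.AlgebraicGeometry.HodgeTheory.GAGADimensionRegularPoint
import Literature.NumberTheory.Transcendental.AnalytificationChartsProofs
import Literature.NumberTheory.Transcendental.AnalytificationUniquenessProofs
import Literature.Geometry.Kaehler.AnalyticSetBiholomorph
import HarnessLib

/-!
# GAGA dimension comparison — proof of `gaga_le_coheight_of_regularLocus_codim`

Final proof file for the named fact
`Literature.AlgebraicGeometry.HodgeTheory.gaga_le_coheight_of_regularLocus_codim` of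
`HodgeTheory/GAGADimension.lean` (Serre, *Géométrie algébrique et géométrie analytique*, §6 Prop. 3
Cor. 2–3, printed p. 11: «Les anneaux `𝒪_x` et `ℋ_x` ont même dimension»; «Si `X` est une variété
algébrique irréductible de dimension `r`, l'espace analytique `X^h` est de dimension analytique `r`
en chacun de ses points»), discharged here: `gaga_le_coheight_of_regularLocus_codim_holds`.

Serre proves Cor. 2 through the completions (`𝒪̂_x = ℋ̂_x`, Prop. 3) and obtains Cor. 3 from §1
n°4. The fact as rendered in the tree only needs, for each point `z` of the Zariski-closed `Z`, ONE
regular point of the analytic set `φ⁻¹(Z(ℂ))` of codimension `≤ codim z`; the Lean proof produces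
it at a *simple point* (§1 n°4, §2 n°6 Cor. 2), where no completion is needed:

1. (`GAGADimensionSimplePoint`) In a standard smooth affine chart `U = Spec A ∋ z` of the smooth
   projective `X`, let `𝔭` be a minimal prime of the ideal of `Z ∩ U` below the prime of `z`
   (an irreducible component of `Z` through `z`; `c := ht 𝔭 ≤ codim z`). Since `A_𝔭` is regular,
   `𝔭` is generated by `c` elements `gⱼ` off a hypersurface; by generic smoothness of `A/𝔭` over
   `ℂ` there is a rational closed point `𝔪 ⊇ 𝔭` off the bad hypersurfaces with `(A/𝔭)_𝔪` regular,
   and then the `gⱼ` are linearly independent modulo `𝔪²` and `A` has local coordinates `tᵢ` at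
   `𝔪` modulo `𝔪²`.
2. (`GAGADimensionCharts`, `GAGADimensionRegularPoint`) On the model `X(ℂ)` of `X^h` with the
   algebraic charts of `Literature.NumberTheory.Transcendental.exists_algebraicChart_holds`, the
   complex point `Q₀` of `𝔪` is a regular point of codimension `c` of `Z(ℂ)`:
   `Z(ℂ) = {g₁ = ⋯ = g_c = 0}` near `Q₀` and `(dg₁, …, dg_c)` is onto.
3. (here) `X(ℂ)` with this atlas is an analytification of `X` (`id`), hence biholomorphic over
   `X(ℂ)` to the given `M` (`IsAnalytification.unique_holds`); regular points and their
   codimension are invariant (`Literature.Geometry.Kaehler.IsRegularPointOfCodim.of_preimage_homeomorph`),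
   so the hypothesis on `M` yields `p ≤ c ≤ codim z` (`coheight` bookkeeping through
   `Spec A → X`, Mathlib `coheight_eq_of_isOpenImmersion`, `idealHeight_eq_coheight`).

Also proved here: `GAGADimension.exists_isStandardSmoothOfRelativeDimension_scalarRingHom'`
(standard smooth affine charts with the canonical scalars at arbitrary points) and
`GAGADimension.mem_basicOpen_iff_notMem_primeIdealOf`.

## References

* J.-P. Serre, *Géométrie algébrique et géométrie analytique*, Ann. Inst. Fourier **6** (1956),
  §1 n°4; §2 n°5 Prop. 2, n°6 Prop. 3 Cor. 2–3 (printed p. 11 = PDF p. 12). [SerreGAGA1956]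
* A. Grothendieck, M. Raynaud, *SGA 1*, Exp. XII, Thm. 1.1, Prop. 3.1 (iv). [SGA1]
-/

noncomputable section

open scoped Manifold ContDiff Topology
open CategoryTheory AlgebraicGeometry Filter
open Literature.AlgebraicGeometry.Motives
open Literature.AlgebraicGeometry.Motives.AlgPoints (evalOrZero evalOrZero_of_mem evalOrZero_of_not_mem)
open Literature.NumberTheory.Transcendental

namespace Literature.AlgebraicGeometry.HodgeTheory

namespace GAGADimension

/-- **Affine standard smooth charts with the canonical scalars**, at an arbitrary (not necessarily
closed) point: a `k`-scheme smooth of relative dimension `d` has at every point an affine open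
neighbourhood `V` whose coordinate ring, as a `k`-algebra via `SchemeOver.scalarRingHom X V`, is
standard smooth of relative dimension `d` (the point-free version of
`AlgPoints.exists_isStandardSmoothOfRelativeDimension_scalarRingHom`). [folklore] -/
theorem exists_isStandardSmoothOfRelativeDimension_scalarRingHom' {k : Type} [Field k]
    (X : SchemeOver k) (d : ℕ) [SmoothOfRelativeDimension d X.hom] (x : X.left) :
    ∃ (V : X.left.Opens) (_ : IsAffineOpen V), x ∈ V ∧
      RingHom.IsStandardSmoothOfRelativeDimension d (SchemeOver.scalarRingHom X V) := by
  obtain ⟨U', -, V, hV, hPV, e, hsm⟩ :=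
    SmoothOfRelativeDimension.exists_isStandardSmoothOfRelativeDimension (n := d) (f := X.hom) x
  have hU'top : U' = ⊤ := by
    ext y
    simp only [TopologicalSpace.Opens.coe_top, Set.mem_univ, iff_true, SetLike.mem_coe]
    obtain rfl : y = X.hom.base x := Subsingleton.elim _ _
    exact e hPV
  subst hU'top
  exact ⟨V, hV, hPV, (RingHom.isStandardSmoothOfRelativeDimension_respectsIso.cancel_left_isIso
    (Scheme.ΓSpecIso (.of k)).inv (X.hom.appLE ⊤ V e)).mpr hsm⟩

/-- Points of an affine open `U` and basic opens: `y ∈ D(f)` iff `f ∉ 𝔭_y`, where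
`𝔭_y ⊂ Γ(X, U)` is the prime of `y` (Mathlib `IsAffineOpen.primeIdealOf`). [folklore] -/
theorem mem_basicOpen_iff_notMem_primeIdealOf {Y : Scheme} {U : Y.Opens} (hU : IsAffineOpen U)
    (y : U) (f : Γ(Y, U)) : (y : Y) ∈ Y.basicOpen f ↔ f ∉ (hU.primeIdealOf y).asIdeal := by
  have h1 : (y : Y) ∈ Y.basicOpen f ↔ hU.primeIdealOf y ∈ hU.fromSpec ⁻¹ᵁ Y.basicOpen f := by
    change _ ↔ hU.fromSpec.base (hU.primeIdealOf y) ∈ Y.basicOpen f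
    rw [hU.fromSpec_primeIdealOf y]
  rw [h1, hU.fromSpec_preimage_basicOpen]
  exact PrimeSpectrum.mem_basicOpen f (hU.primeIdealOf y)

end GAGADimension

open GAGADimension in
/-- **Discharge of `gaga_le_coheight_of_regularLocus_codim`** (Serre, *GAGA* §6 Prop. 3 Cor. 2–3,
p. 11: «Les anneaux `𝒪_x` et `ℋ_x` ont même dimension»; «l'espace analytique `X^h` est de dimension
analytique `r` en chacun de ses points»), in the rendering consumed by the Hodge files: for an
analytification `φ : M → X(ℂ)` of a smooth projective `n`-fold and a Zariski-closed `Z ⊆ X`, if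
every regular point of `φ⁻¹(Z(ℂ))` has complex codimension `≥ p` then every scheme point of `Z`
has codimension `≥ p`. Proof (Serre §1 n°4, §2 n°6 Cor. 2 at a simple point, in Lean): for `z ∈ Z`
take a standard smooth affine chart `U = Spec A ∋ z`, a minimal prime `𝔭` of the ideal of `Z ∩ U`
below the prime of `z` (`c = ht 𝔭 ≤ codim z`), and the simple-point data of
`GAGADimension.exists_simplePointData` — `c` generators `gⱼ` of `𝔭` off `V(h)`, a rational
regular closed point `𝔪 ⊇ 𝔭` of `A/𝔭` off `V(h h₀)` with the `gⱼ` independent modulo `𝔪²`, local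
coordinates `tᵢ`; the complex point `Q₀` of `𝔪` is then a regular point of codimension `c` of
`Z(ℂ)` in the algebraic-chart model of `X^h` (`GAGADimension.isRegularPointOfCodim_of_simplePoint`:
`Z(ℂ) = {g = 0}` near `Q₀` with `dg` onto), which is biholomorphic to `M` over `X(ℂ)`
(`IsAnalytification.unique_holds`), so `M` has a regular point of codimension `c` in
`φ⁻¹(Z(ℂ))`; the hypothesis gives `p ≤ c ≤ codim z`.
[cite: SerreGAGA1956, §6 Prop. 3 Cor. 2–3 (p. 11) with §1 n°4 and §2 n°6 Cor. 2] -/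
theorem gaga_le_coheight_of_regularLocus_codim_holds : gaga_le_coheight_of_regularLocus_codim := by
  intro n X hX E _ _ _ M _ _ _ φ hφ p Z hZ H z hz
  classical
  -- instances on `X`
  haveI : IsIntegral X.left := Motives.IsSmoothProjective.isIntegral_holds hX
  haveI := hX.smoothOfRelativeDimension
  haveI : LocallyOfFiniteType X.hom := by
    haveI : Smooth X.hom := SmoothOfRelativeDimension.smooth n _
    infer_instance
  -- Step 1: a standard smooth affine chart `U = Spec A ∋ z`
  obtain ⟨U, hU, hzU, hsm⟩ := exists_isStandardSmoothOfRelativeDimension_scalarRingHom' X n z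
  letI : Algebra ℂ Γ(X.left, U) := (SchemeOver.scalarRingHom X U).toAlgebra
  haveI : Algebra.IsStandardSmoothOfRelativeDimension n ℂ Γ(X.left, U) := hsm
  haveI : Nonempty U := ⟨⟨z, hzU⟩⟩
  haveI : IsDomain Γ(X.left, U) := IsIntegral.component_integral U
  haveI : Algebra.IsStandardSmooth ℂ Γ(X.left, U) :=
    Algebra.IsStandardSmoothOfRelativeDimension.isStandardSmooth n
  haveI : IsNoetherianRing Γ(X.left, U) := Algebra.FiniteType.isNoetherianRing ℂ _
  -- Step 2: the ideal of `Z ∩ U` and the prime of `z`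
  set Z' : Set (Spec Γ(X.left, U)) := hU.fromSpec.base ⁻¹' Z with hZ'def
  have hZ'cl : IsClosed Z' := hZ.preimage hU.fromSpec.base.hom.continuous
  set I : Ideal Γ(X.left, U) := PrimeSpectrum.vanishingIdeal Z' with hIdef
  have hZI : ∀ q : Spec Γ(X.left, U), q ∈ Z' ↔ I ≤ q.asIdeal := fun q => by
    have h1 : PrimeSpectrum.zeroLocus (I : Set Γ(X.left, U)) = Z' := by
      rw [hIdef, PrimeSpectrum.zeroLocus_vanishingIdeal_eq_closure]
      exact hZ'cl.closure_eq
    rw [← h1]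
    rfl
  set qz : Spec Γ(X.left, U) := hU.primeIdealOf ⟨z, hzU⟩ with hqzdef
  have hqz : hU.fromSpec.base qz = z := hU.fromSpec_primeIdealOf ⟨z, hzU⟩
  have hIqz : I ≤ qz.asIdeal := (hZI qz).1 (show hU.fromSpec.base qz ∈ Z by rw [hqz]; exact hz)
  -- Step 3: a minimal prime `𝔭` of `I` below `qz`, isolated off `V(h₀)`
  obtain ⟨𝔭, h𝔭min, h𝔭qz, h₀, hh₀𝔭, hiso⟩ := exists_minimalPrime_forall_iff I qz.asIdeal hIqz
  haveI h𝔭prime : 𝔭.IsPrime := h𝔭min.1.1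
  -- Step 4: the simple-point data
  obtain ⟨c, g, h, 𝔪, h𝔪max, ψ, t, hc, hg𝔭, hgen, h𝔭𝔪, hh𝔪, hh₀𝔪, hψ, hindep, ht𝔪, htspan⟩ :=
    exists_simplePointData ℂ Γ(X.left, U) n 𝔭 h₀ hh₀𝔭
  -- Step 5: the complex point `Q₀` of `𝔪`
  have hψcomp : ψ.toRingHom.comp (SchemeOver.scalarRingHom X U) = algebraMap ℂ ℂ :=
    RingHom.ext fun a => ψ.commutes a
  set Q₀ : ComplexPoints X := AlgPoints.ofRingHom hU ψ.toRingHom hψcomp with hQ₀def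
  have hQ₀U : Q₀.pt ∈ U := AlgPoints.pt_ofRingHom_mem hU _ hψcomp
  have hQ₀eval : ∀ a, Q₀.eval U hQ₀U a = ψ a := fun a =>
    AlgPoints.eval_ofRingHom hU _ hψcomp hQ₀U a
  have hker : RingHom.ker (Q₀.evalRingHom U hQ₀U) = 𝔪 := Ideal.ext fun a => by
    rw [RingHom.mem_ker, AlgPoints.evalRingHom_apply, hQ₀eval]
    exact hψ a
  -- Step 6: the model `X(ℂ)` of `X^h` with algebraic charts
  choose chart mem alg hol using fun P : ComplexPoints X => exists_algebraicChart_holds X n P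
  letI cs : ChartedSpace (Fin n → ℂ) (ComplexPoints X) := chartedSpaceOfCharts chart mem
  haveI hM₀ : IsManifold 𝓘(ℂ, Fin n → ℂ) ω (ComplexPoints X) :=
    isManifold_chartedSpaceOfCharts chart mem alg hol
  have hid : IsAnalytification (Fin n → ℂ) X n (id : ComplexPoints X → ComplexPoints X) := by
    refine ⟨IsHomeomorph.id, by simp, ?_⟩
    intro V s m hm
    simp only [Set.preimage_id_eq, id_eq, Set.mem_setOf_eq] at hm
    refine MDifferentiableAt.mdifferentiableWithinAt ?_
    rw [mdifferentiableAt_iff]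
    refine ⟨(AlgPoints.continuousOn_evalOrZero _ s).continuousAt
      ((AlgPoints.isOpen_setOf_pt_mem _).mem_nhds hm), ?_⟩
    simp only [writtenInExtChartAt, extChartAt, OpenPartialHomeomorph.extend,
      modelWithCornersSelf_partialEquiv, PartialEquiv.trans_refl, modelWithCornersSelf_coe,
      Set.range_id, OpenPartialHomeomorph.toFun_eq_coe,
      OpenPartialHomeomorph.coe_toPartialEquiv_symm]
    refine DifferentiableAt.differentiableWithinAt ?_
    have hopen : IsOpen ((chart m).target ∩ (chart m).symm ⁻¹' {Q | Q.pt ∈ (↑V : X.left.Opens)}) :=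
      (chart m).isOpen_inter_preimage_symm (AlgPoints.isOpen_setOf_pt_mem _)
    have hmem : chart m m ∈ (chart m).target ∩ (chart m).symm ⁻¹' {Q | Q.pt ∈ (↑V : X.left.Opens)} :=
      ⟨(chart m).map_source (mem m), by
        simp only [Set.mem_preimage, Set.mem_setOf_eq, (chart m).left_inv (mem m)]; exact hm⟩
    exact ((hol m V s).differentiableOn (by simp)).differentiableAt (hopen.mem_nhds hmem)
  have hmd : ∀ s : Γ(X.left, U), MDifferentiableOn 𝓘(ℂ, Fin n → ℂ) 𝓘(ℂ, ℂ) (evalOrZero U s)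
      {Q : ComplexPoints X | Q.pt ∈ U} := fun s =>
    hid.mdifferentiableOn_evalOrZero ⟨U, hU⟩ s
  -- Step 7: `Q₀` is a regular point of codimension `c` of `Z(ℂ)` in the model
  have hbasic : ∀ (Q : ComplexPoints X) (hQ : Q.pt ∈ U) (f : Γ(X.left, U)),
      Q.pt ∈ X.left.basicOpen f ↔ f ∉ (hU.primeIdealOf ⟨Q.pt, hQ⟩).asIdeal := fun Q hQ f =>
    mem_basicOpen_iff_notMem_primeIdealOf hU ⟨Q.pt, hQ⟩ f
  have hevalmem : ∀ (Q : ComplexPoints X) (hQ : Q.pt ∈ U) (f : Γ(X.left, U)),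
      Q.eval U hQ f = 0 ↔ f ∈ (hU.primeIdealOf ⟨Q.pt, hQ⟩).asIdeal := fun Q hQ f =>
    not_iff_not.1 ((AlgPoints.pt_mem_basicOpen_iff Q hQ f).symm.trans (hbasic Q hQ f))
  have hhQ₀ : Q₀.pt ∈ X.left.basicOpen (h * h₀) := by
    rw [AlgPoints.pt_mem_basicOpen_iff Q₀ hQ₀U, hQ₀eval, Ne, hψ]
    exact fun hm => (Ideal.IsPrime.mem_or_mem inferInstance hm).elim hh𝔪 hh₀𝔪
  have hZeq : ∀ (Q : ComplexPoints X) (hQ : Q.pt ∈ X.left.basicOpen (h * h₀)),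
      Q.pt ∈ Z ↔ ∀ j, Q.eval U (X.left.basicOpen_le _ hQ) (g j) = 0 := by
    intro Q hQ
    have hQU : Q.pt ∈ U := X.left.basicOpen_le _ hQ
    set q := hU.primeIdealOf ⟨Q.pt, hQU⟩ with hqdef
    have hq : hU.fromSpec.base q = Q.pt := hU.fromSpec_primeIdealOf ⟨Q.pt, hQU⟩
    have hhq : h * h₀ ∉ q.asIdeal := (hbasic Q hQU _).1 hQ
    have hh₀q : h₀ ∉ q.asIdeal := fun hm => hhq (Ideal.mul_mem_left _ _ hm)
    have hhq' : h ∉ q.asIdeal := fun hm => hhq (Ideal.mul_mem_right _ _ hm)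
    calc Q.pt ∈ Z ↔ q ∈ Z' := by rw [← hq]; rfl
      _ ↔ I ≤ q.asIdeal := hZI q
      _ ↔ 𝔭 ≤ q.asIdeal := hiso q.asIdeal q.2 hh₀q
      _ ↔ ∀ j, g j ∈ q.asIdeal := by
          refine ⟨fun hle j => hle (hg𝔭 j), fun hgq a ha => ?_⟩
          have h1 : h * a ∈ q.asIdeal := by
            refine (Ideal.span_le.2 ?_ : Ideal.span (Set.range g) ≤ q.asIdeal) (hgen a ha)
            rintro _ ⟨j, rfl⟩
            exact hgq j
          exact ((Ideal.IsPrime.mem_or_mem q.2 h1).resolve_left hhq')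
      _ ↔ ∀ j, Q.eval U hQU (g j) = 0 := by
          rw [hqdef]
          exact forall_congr' fun j => (hevalmem Q hQU (g j)).symm
  have htspan' : ∀ a ∈ RingHom.ker (Q₀.evalRingHom U hQ₀U), ∃ coef : Fin n → ℂ,
      a - ∑ i, SchemeOver.scalarRingHom X U (coef i) * t i ∈
        RingHom.ker (Q₀.evalRingHom U hQ₀U) ^ 2 := by
    rw [hker]
    intro a ha
    obtain ⟨coef, hcoef⟩ := htspan a ha
    refine ⟨coef, ?_⟩
    simp only [Algebra.smul_def] at hcoef
    exact hcoef
  have hg' : ∀ j, g j ∈ RingHom.ker (Q₀.evalRingHom U hQ₀U) := fun j => by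
    rw [hker]
    exact h𝔭𝔪 (hg𝔭 j)
  have hindep' : ∀ coef : Fin c → ℂ,
      ∑ j, SchemeOver.scalarRingHom X U (coef j) * g j ∈ RingHom.ker (Q₀.evalRingHom U hQ₀U) ^ 2 →
        coef = 0 := by
    rw [hker]
    intro coef hmem
    refine hindep coef ?_
    simp only [Algebra.smul_def]
    exact hmem
  have hreg : Literature.Geometry.Kaehler.IsRegularPointOfCodim 𝓘(ℂ, Fin n → ℂ)
      {Q : ComplexPoints X | Q.pt ∈ Z} c Q₀ :=
    isRegularPointOfCodim_of_simplePoint (chart Q₀) rfl (mem Q₀) (hol Q₀) (alg Q₀) ⟨U, hU⟩ hQ₀U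
      hmd t htspan' g hg' hindep' (h * h₀) hhQ₀ Z hZeq
  have hQ₀Z : Q₀.pt ∈ Z := by
    refine (hZeq Q₀ hhQ₀).2 fun j => ?_
    have := hg' j
    rwa [RingHom.mem_ker, AlgPoints.evalRingHom_apply] at this
  -- Step 8: transport to `M` along the biholomorphism `X(ℂ) ≃ M` over `X(ℂ)`
  obtain ⟨χ, hχ, hχs, hcomp⟩ :=
    IsAnalytification.unique_holds (E := Fin n → ℂ) (E' := E) (M := ComplexPoints X) (M' := M)
      hid hφ
  have hpre : χ ⁻¹' (φ ⁻¹' {P : ComplexPoints X | P.pt ∈ Z}) = {Q | Q.pt ∈ Z} := by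
    ext Q
    simp only [Set.mem_preimage, Set.mem_setOf_eq]
    rw [show φ (χ Q) = Q from congrFun hcomp Q]
  have hreg' : Literature.Geometry.Kaehler.IsRegularPointOfCodim 𝓘(ℂ, E)
      (φ ⁻¹' {P : ComplexPoints X | P.pt ∈ Z}) c (χ Q₀) :=
    Literature.Geometry.Kaehler.IsRegularPointOfCodim.of_preimage_homeomorph χ hχ hχs
      (by rw [hpre]; exact hreg)
  have hmemS : χ Q₀ ∈ φ ⁻¹' {P : ComplexPoints X | P.pt ∈ Z} := by
    change (φ (χ Q₀)).pt ∈ Z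
    rw [show φ (χ Q₀) = Q₀ from congrFun hcomp Q₀]
    exact hQ₀Z
  have hpc : p ≤ c := H (χ Q₀) ⟨hmemS, c, hreg'⟩ c hreg'
  -- Step 9: `c = ht 𝔭 = codim z₀ ≤ codim z`
  let y₀ : Spec Γ(X.left, U) := ⟨𝔭, h𝔭prime⟩
  have hcoh₀ : Order.coheight y₀ = c := by
    rw [← idealHeight_eq_coheight]
    exact hc.symm
  have hle : Order.coheight y₀ ≤ Order.coheight qz := by
    refine Order.coheight_anti (Scheme.le_iff_specializes.2 ?_)
    exact (PrimeSpectrum.le_iff_specializes y₀ qz).1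
      ((PrimeSpectrum.asIdeal_le_asIdeal y₀ qz).1 h𝔭qz)
  have hcohz : Order.coheight z = Order.coheight qz := by
    rw [← hqz]
    exact coheight_eq_of_isOpenImmersion hU.fromSpec
  calc (p : ℕ∞) ≤ c := by exact_mod_cast hpc
    _ = Order.coheight y₀ := hcoh₀.symm
    _ ≤ Order.coheight qz := hle
    _ = Order.coheight z := hcohz.symm

end Literature.AlgebraicGeometry.HodgeTheory
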